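import Summits.BirchSwinnertonDyer.BirchSwinnertonDyer.Theorems.SylvesterTwoHeegnerIndexYinToricTransfer
import Literature.NumberTheory.EllipticCurves.VariableChangePointsMap
import HarnessLib

/-!
# Route `SylvesterTwoHeegnerIndex` (rung K7t): the transfer principle ASSEMBLED — from `Y ∈ 2B(K) + tors`
# to the `2`-divisibility of the anti-trace's twist point in `B_K^{(d)}(K)` (model glue included)

HONEST FRAMING (cell b2b-bsdres, seat x1b GEN 54 = O12 class lead; file `--supports
stmt-BirchSwinnertonDyer-19891 --as helper`; closes no item; no mechanism, no definition, no named fact; no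
label moves; BSD is not claimed). Sequel of x1b [166] `…YinToricTransfer` (bsd-cm-two MEMO v2.11 §54.3 as
kernel algebra). [166] §2 works on an arbitrary model `B/ℚ` (the binder's `B ≅ E_p`, globally minimal),
[166] §3 on the completed-square model `W¹ = W.quadraticTwist 1` of the tree's twist dictionary. This file
supplies the GLUE and the ASSEMBLED statement:

* §1 transport of «`R − cR ∈ 2M + tors`» along any additive isomorphism `Φ` intertwining `c` and `c′`;
* §2 **MODEL GLUE**: for fields `K ⊂ L` of characteristic `0` and any `B/ℚ` there is an additive isomorphism
  `Φ : B(L) ≃+ (B_K)¹(L)` (`B_K = B.baseChange K`, `(B_K)¹` its completed square, a `K`-model) commuting with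
  every `σ ∈ Aut(L/K)` — completing the square is a change of variables over `K`
  (`QuadraticTwist.exists_variableChange_quadraticTwist_one`) and the substitution is Galois-equivariant
  (`VariableChange.pointEquivBaseChange_map_algEquiv`); the identification `(B_K)_L = B_L` is Mathlib's
  `map_baseChange`;
* §3 **THE ASSEMBLED TRANSFER.** `L/K` quadratic Galois (`L = K(θ′)`, `θ′² = d ∈ K`, `c ≠ 1`), `B(L)[2] = 0`,
  `θ` an additive automorphism of `B(L)`, `N` odd, `N • ι Y = −θ(R + cR) + T` (`TraceRelationAtTwo`), `T`
  torsion; `Φ` any `c`-equivariant `B(L) ≃+ (B_K)¹(L)` (§2) and `Q ∈ (B_K)^{(d)}(K)` the twist point of the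
  anti-trace, `τQ = ΦR − c(ΦR)` (it exists: [166] `exists_twistMap_eq_sub_conjMap`). THEN
  «`Y ∈ 2B(K) + B(K)_tors`» ⟺ «`Q ∈ 2(B_K)^{(d)}(K) + tors`» (`twoDivisible_iff_twist_twoDivisible_of_traceRelation`),
  and the contrapositive PRIMITIVITY TRANSFER. For `L = K(i)`, `d = −1`: MEMO §54.3 «`Z_p` is a `2`-adic
  generator of `E_p(K)` ⟺ `y_{χκ}` is a `2`-adic generator of `E_p^{(−1)}(K)`» — its algebraic half; that
  the twist point IS the sextic Heegner point `y_{χκ}` (YZZ) and anything about `L′(E_p^{(−1)}, 1)` are NOT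
  claimed here.

NO definition, NO named fact, NO sorry; axioms standard. References: MEMO-bsd-cm-two v2.11 §54.3; x1b [166];
Silverman AEC III.1 (changes of variables), X.2 Prop. 2.4 / Exercise 10.16, VIII.§1.
-/

set_option autoImplicit false
-- the Summit-side namespace `Summit.BirchSwinnertonDyer.BirchSwinnertonDyer.…` (summit = problem) is mandated by D-0017
set_option linter.dupNamespace false

noncomputable section

open scoped Classical

open WeierstrassCurve WeierstrassCurve.Affine WeierstrassCurve.Affine.Point WeierstrassCurve.QuadraticDescent
open Summit.BirchSwinnertonDyer.BirchSwinnertonDyer.Theorems.SylvesterTwoYinToric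
  Literature.NumberTheory.EllipticCurves

namespace Summit.BirchSwinnertonDyer.BirchSwinnertonDyer.Theorems.SylvesterTwoYinToricTransfer

/-! ## §1 Transport of «anti-trace `2`-divisible modulo torsion» along an equivariant isomorphism -/

section Transport

variable {M M' : Type*} [AddCommGroup M] [AddCommGroup M']

/-- If `Φ : M ≃+ M′` intertwines `c` on `M` with `c′` on `M′`, then «`R − cR ∈ 2M + tors`» iff
«`ΦR − c′(ΦR) ∈ 2M′ + tors`» (x1b [166] `exists_eq_two_smul_add_torsion_iff_of_addEquiv` applied to
`Φ(R − cR) = ΦR − c′(ΦR)`). [folklore] -/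
theorem exists_eq_two_smul_add_torsion_sub_iff_of_semiconj (Φ : M ≃+ M') (c : M →+ M) (c' : M' →+ M')
    (hΦ : ∀ P : M, Φ (c P) = c' (Φ P)) (R : M) :
    (∃ S T : M, IsOfFinAddOrder T ∧ R - c R = (2 : ℤ) • S + T) ↔
      ∃ S T : M', IsOfFinAddOrder T ∧ Φ R - c' (Φ R) = (2 : ℤ) • S + T := by
  rw [← hΦ, ← map_sub]
  exact (exists_eq_two_smul_add_torsion_iff_of_addEquiv Φ (R - c R)).symm

/-- «No `2`-torsion» transports along an additive isomorphism. [folklore] -/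
theorem forall_two_nsmul_eq_zero_of_addEquiv (Φ : M ≃+ M') (h : ∀ Q : M, (2 : ℕ) • Q = 0 → Q = 0)
    (P : M') (hP : (2 : ℕ) • P = 0) : P = 0 := by
  have h' : Φ.symm P = 0 := h _ (by rw [← map_nsmul, hP, _root_.map_zero])
  have h'' := congrArg Φ h'
  rwa [AddEquiv.apply_symm_apply, _root_.map_zero] at h''

end Transport

/-! ## §2 MODEL GLUE: `B(L) ≃+ (B_K)¹(L)`, Galois-equivariantly -/

section Glue

-- `K L : Type`: bsd-cm-two's `TraceRelationAtTwo` is stated over `Type`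
variable {K L : Type} [Field K] [CharZero K] [Field L] [CharZero L] [Algebra K L]
  (B : WeierstrassCurve ℚ)

/-- `(B_K)_L = B_L` (Mathlib `map_baseChange` for `K → L`). [folklore] -/
theorem baseChange_baseChange_eq : (B.baseChange K).baseChange L = B.baseChange L :=
  B.map_baseChange (Algebra.ofId K L)

/-- Transport along `B_L = (B_K)_L` commutes with the Galois action on coordinates (both sides act by `σ`
on the two coordinates). [folklore] -/
theorem congrEquiv_baseChange_map_algEquiv (σ : L ≃ₐ[K] L) (P : (B.baseChange L).toAffine.Point) :
    Affine.Point.congrEquiv (baseChange_baseChange_eq (K := K) (L := L) B).symm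
        (Affine.Point.map (W' := B) (σ : L →ₐ[K] L) P) =
      Affine.Point.map (W' := B.baseChange K) (σ : L →ₐ[K] L)
        (Affine.Point.congrEquiv (baseChange_baseChange_eq (K := K) (L := L) B).symm P) := by
  rcases P with _ | ⟨x, y, h⟩
  · simp only [← Affine.Point.zero_def, _root_.map_zero]
  · simp only [Affine.Point.map_some, Affine.Point.congrEquiv_some]

omit [CharZero K] [CharZero L] in
/-- Transport along the base change of an equality of `K`-models commutes with the Galois action. [folklore] -/
theorem congrEquiv_congrArg_baseChange_map_algEquiv {V₁ V₂ : WeierstrassCurve K} (h : V₁ = V₂)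
    (σ : L ≃ₐ[K] L) (P : (V₁.baseChange L).toAffine.Point) :
    Affine.Point.congrEquiv (congrArg (fun V : WeierstrassCurve K => V.baseChange L) h)
        (Affine.Point.map (W' := V₁) (σ : L →ₐ[K] L) P) =
      Affine.Point.map (W' := V₂) (σ : L →ₐ[K] L)
        (Affine.Point.congrEquiv (congrArg (fun V : WeierstrassCurve K => V.baseChange L) h) P) := by
  subst h
  rfl

/-- **MODEL GLUE.** For fields `K ⊂ L` of characteristic `0` and any `B/ℚ` there is an additive
isomorphism `Φ : B(L) ≃+ (B_K)¹(L)` onto the `L`-points of the completed-square model `(B_K)¹ =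
(B.baseChange K).quadraticTwist 1` which commutes with every `σ ∈ Aut(L/K)`: the completing-the-square
change of variables `C = (1, 0, −a₁/2, −a₃/2)` is defined over `K` (tree
`exists_variableChange_quadraticTwist_one`), and substitutions defined over `K` are Galois-equivariant on
`L`-points (tree `VariableChange.pointEquivBaseChange_map_algEquiv`). Silverman AEC III.1, VIII.§1.
[cite: SilvermanAEC2009, III.3.1(b)] -/
theorem exists_equivariant_addEquiv_quadraticTwist_one :
    ∃ Φ : (B.baseChange L).toAffine.Point ≃+
        (((B.baseChange K).quadraticTwist 1).baseChange L).toAffine.Point,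
      ∀ (σ : L ≃ₐ[K] L) (P : (B.baseChange L).toAffine.Point),
        Φ (Affine.Point.map (W' := B) (σ : L →ₐ[K] L) P) =
          conjMap ((B.baseChange K).quadraticTwist 1) (σ : L →ₐ[K] L) (Φ P) := by
  obtain ⟨C, hC⟩ := exists_variableChange_quadraticTwist_one (B.baseChange K)
  refine ⟨((Affine.Point.congrEquiv (baseChange_baseChange_eq (K := K) (L := L) B).symm).trans
      (VariableChange.pointEquivBaseChange (B.baseChange K) C L)).trans
      (Affine.Point.congrEquiv (congrArg (fun V : WeierstrassCurve K => V.baseChange L) hC)),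
    fun σ P => ?_⟩
  simp only [AddEquiv.trans_apply]
  rw [congrEquiv_baseChange_map_algEquiv, VariableChange.pointEquivBaseChange_map_algEquiv,
    congrEquiv_congrArg_baseChange_map_algEquiv hC]

omit [CharZero K] [CharZero L] in
/-- A non-trivial `K`-automorphism of `L` is non-trivial as a `K`-algebra endomorphism. [folklore] -/
theorem coe_ne_id_of_ne_refl {c : L ≃ₐ[K] L} (hc : c ≠ AlgEquiv.refl) :
    (c : L →ₐ[K] L) ≠ AlgHom.id K L := by
  intro h
  apply hc
  ext x
  exact DFunLike.congr_fun h x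

end Glue

/-! ## §3 THE ASSEMBLED TRANSFER: `Y ∈ 2B(K) + tors` versus the twist point of the anti-trace -/

section Assembled

open Literature.NumberTheory.QuadraticFields

variable {K L : Type} [Field K] [CharZero K] [Field L] [CharZero L] [Algebra K L]
  (B : WeierstrassCurve ℚ)

/-- **THE TWIST POINT OF THE ANTI-TRACE EXISTS.** `L = K(θ′)` quadratic, `θ′² = d ∈ K`, `c ≠ 1` in
`Aut(L/K)`, `Φ : B(L) ≃+ (B_K)¹(L)` (any map): the anti-trace `ΦR − c(ΦR)` is `τQ` for some
`Q ∈ (B_K)^{(d)}(K)` (x1b [166] `exists_twistMap_eq_sub_conjMap`). [cite: SilvermanAEC2009, Exercise 10.16] -/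
theorem exists_twist_point_of_antiTrace (h2L : Module.finrank K L = 2) {θ' : L} {d : K}
    (hθ' : θ' ∉ Set.range (algebraMap K L)) (hd : θ' ^ 2 = algebraMap K L d)
    {c : L ≃ₐ[K] L} (hc : c ≠ AlgEquiv.refl)
    (Φ : (B.baseChange L).toAffine.Point ≃+ (((B.baseChange K).quadraticTwist 1).baseChange L).toAffine.Point)
    (R : (B.baseChange L).toAffine.Point) :
    ∃ Q : ((B.baseChange K).quadraticTwist d).toAffine.Point,
      twistMap (B.baseChange K) hθ' hd Q =
        Φ R - conjMap ((B.baseChange K).quadraticTwist 1) (c : L →ₐ[K] L) (Φ R) :=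
  exists_twistMap_eq_sub_conjMap (B.baseChange K) h2L hθ' hd (coe_ne_id_of_ne_refl hc) (Φ R)

/-- **THE ASSEMBLED TRANSFER OF `2`-DIVISIBILITY (MEMO-bsd-cm-two v2.11 §54.3, algebraic half, kernel).**
`K ⊂ L = K(θ′)` fields of characteristic `0`, `θ′² = d ∈ K`, `θ′ ∉ K`, `L/K` Galois, `c ∈ Aut(L/K)`;
`B/ℚ` with `B(L)[2] = 0`; `θ` an additive automorphism of `B(L)`; `N` odd; the trace relation
`N • ι Y = −θ(R + cR) + T` with `T` torsion (two's `TraceRelationAtTwo`); `Φ : B(L) ≃+ (B_K)¹(L)` any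
`c`-equivariant additive isomorphism onto the completed-square model (exists: §2), and
`Q ∈ (B_K)^{(d)}(K)` with `τQ = ΦR − c(ΦR)` (exists: `exists_twist_point_of_antiTrace`). THEN
«`Y = 2•Y′ + T″` in `B(K)`, `T″` torsion» ⟺ «`Q = 2•Q′ + T′` in `(B_K)^{(d)}(K)`, `T′` torsion».
Chain: [166] §2 (binder level) → §1 transport along `Φ` → [166] §3 (twist layer; `(B_K)¹(L)[2] = 0`
transported from `B(L)[2] = 0`). For the CM field `K ∋ ω`, `L = K(i)`, `d = −1` this reads: Yin-type
point `2`-divisible in `E(K)/tors` ⟺ the anti-trace's twist point `2`-divisible in `E^{(−1)}(K)/tors`.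
ONE factor of `2` only (memo §54.4). [cite: SilvermanAEC2009, Exercise 10.16] -/
theorem twoDivisible_iff_twist_twoDivisible_of_traceRelation [IsGalois K L] [FiniteDimensional K L]
    (hL2 : ∀ P : (B.baseChange L).toAffine.Point, (2 : ℕ) • P = 0 → P = 0)
    (h2L : Module.finrank K L = 2) {θ' : L} {d : K}
    (hθ' : θ' ∉ Set.range (algebraMap K L)) (hd : θ' ^ 2 = algebraMap K L d) (c : L ≃ₐ[K] L)
    (θ : (B.baseChange L).toAffine.Point ≃+ (B.baseChange L).toAffine.Point) {N : ℤ} (hN : Odd N)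
    {Y : (B.baseChange K).toAffine.Point} {R T : (B.baseChange L).toAffine.Point}
    (hT : IsOfFinAddOrder T) (htrace : TraceRelationAtTwo B K L c (θ : _ →+ _) N Y R T)
    (Φ : (B.baseChange L).toAffine.Point ≃+ (((B.baseChange K).quadraticTwist 1).baseChange L).toAffine.Point)
    (hΦ : ∀ P : (B.baseChange L).toAffine.Point,
      Φ (Affine.Point.map (W' := B) (c : L →ₐ[K] L) P) =
        conjMap ((B.baseChange K).quadraticTwist 1) (c : L →ₐ[K] L) (Φ P))
    {Q : ((B.baseChange K).quadraticTwist d).toAffine.Point}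
    (hQ : twistMap (B.baseChange K) hθ' hd Q =
      Φ R - conjMap ((B.baseChange K).quadraticTwist 1) (c : L →ₐ[K] L) (Φ R)) :
    (∃ Y' T'' : (B.baseChange K).toAffine.Point, IsOfFinAddOrder T'' ∧ Y = (2 : ℤ) • Y' + T'') ↔
      ∃ Q' T' : ((B.baseChange K).quadraticTwist d).toAffine.Point,
        IsOfFinAddOrder T' ∧ Q = (2 : ℤ) • Q' + T' := by
  have hK2 : ∀ P : (((B.baseChange K).quadraticTwist 1).baseChange L).toAffine.Point,
      (2 : ℕ) • P = 0 → P = 0 :=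
    forall_two_nsmul_eq_zero_of_addEquiv Φ hL2
  rw [twoDivisible_iff_antiTrace_twoDivisible_of_traceRelation B hL2 c θ hN hT htrace,
    exists_eq_two_smul_add_torsion_sub_iff_of_semiconj Φ
      (Affine.Point.map (W' := B) (c : L →ₐ[K] L))
      (conjMap ((B.baseChange K).quadraticTwist 1) (c : L →ₐ[K] L)) hΦ R]
  exact twoDivisible_sub_conjMap_iff_of_twistMap_eq (B.baseChange K) h2L hθ' hd hK2
    (c : L →ₐ[K] L) (Φ R) hQ

/-- **THE ASSEMBLED PRIMITIVITY TRANSFER** (contrapositive): same hypotheses, «`Y ∉ 2B(K) + tors`» ⟺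
«the twist point `Q` of the anti-trace is `2`-primitive in `(B_K)^{(d)}(K)/tors`». MEMO-bsd-cm-two v2.11
§54.3 for `p ≡ 4 (9)` («`Z_p` `2`-adic generator ⟺ `y_{χκ}` `2`-adic generator»), algebraic half only.
[cite: SilvermanAEC2009, Exercise 10.16] -/
theorem twoPrimitive_iff_twist_twoPrimitive_of_traceRelation [IsGalois K L] [FiniteDimensional K L]
    (hL2 : ∀ P : (B.baseChange L).toAffine.Point, (2 : ℕ) • P = 0 → P = 0)
    (h2L : Module.finrank K L = 2) {θ' : L} {d : K}
    (hθ' : θ' ∉ Set.range (algebraMap K L)) (hd : θ' ^ 2 = algebraMap K L d) (c : L ≃ₐ[K] L)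
    (θ : (B.baseChange L).toAffine.Point ≃+ (B.baseChange L).toAffine.Point) {N : ℤ} (hN : Odd N)
    {Y : (B.baseChange K).toAffine.Point} {R T : (B.baseChange L).toAffine.Point}
    (hT : IsOfFinAddOrder T) (htrace : TraceRelationAtTwo B K L c (θ : _ →+ _) N Y R T)
    (Φ : (B.baseChange L).toAffine.Point ≃+ (((B.baseChange K).quadraticTwist 1).baseChange L).toAffine.Point)
    (hΦ : ∀ P : (B.baseChange L).toAffine.Point,
      Φ (Affine.Point.map (W' := B) (c : L →ₐ[K] L) P) =
        conjMap ((B.baseChange K).quadraticTwist 1) (c : L →ₐ[K] L) (Φ P))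
    {Q : ((B.baseChange K).quadraticTwist d).toAffine.Point}
    (hQ : twistMap (B.baseChange K) hθ' hd Q =
      Φ R - conjMap ((B.baseChange K).quadraticTwist 1) (c : L →ₐ[K] L) (Φ R)) :
    (¬ ∃ Y' T'' : (B.baseChange K).toAffine.Point, IsOfFinAddOrder T'' ∧ Y = (2 : ℤ) • Y' + T'') ↔
      ¬ ∃ Q' T' : ((B.baseChange K).quadraticTwist d).toAffine.Point,
        IsOfFinAddOrder T' ∧ Q = (2 : ℤ) • Q' + T' :=
  not_congr (twoDivisible_iff_twist_twoDivisible_of_traceRelation B hL2 h2L hθ' hd c θ hN hT htrace Φ hΦ hQ)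

end Assembled

end Summit.BirchSwinnertonDyer.BirchSwinnertonDyer.Theorems.SylvesterTwoYinToricTransfer

end
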